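import Summits.QuantumAdvantage.QuantumAdvantage.Theorems.CubicForrelationNearExactIsExactTwelveWindowPairing
import Summits.QuantumAdvantage.QuantumAdvantage.Theorems.CubicForrelationNearExactIsExactTwelveWindowHalfSpectrum

/-!
# Crux `CubicForrelation.NearExactIsExact` (stmt-QuantumAdvantage-14043) — n = 12 window `(59/64, 1)`: the sign pattern on the odd
  hyperplane is RELATIVELY BENT

Certificate seat `b2b-cforr-cert` (gen 14).  HONEST FRAMING: lemmas (standard axioms) for the theorem `θ₁₂ ≤ 59/64`
(`…TwelveWindow5964.lean`): finite Fourier bookkeeping about a hypothetical cubic pair on 12 bits, NOT summit progress.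
Setting (all hypotheses explicit): `W_g = 32u'`, `W_f = 32v'`; odd hyperplanes `P_g = {(−1)^{γ·x} = t_g}`, `P_f = {(−1)^{c·z} = t_f}`,
the pair exact off them; the quadratic digit `D̄` of `…HalfSpectrum` (`e_g ≡ (−1)^{D̄} (mod 4)` on `P_g`); `G := (−1)^{D̄}·1_{P_g}`,
`R := e_g − G`.  Results: `tw59_WG_off` (`W_G = 0` off `P_f`, by periodicity), `tw59_WR_eq` (`W_R = −64 e_f − W_G`), `tw59_R_sq_le`
(`Σ R² ≤ 2S`, `S = 2¹⁵(1−Φ) − 2048 < 512`), `tw59_support_gt` (fewer than `1024` zeros of `W_G` on `P_f`), `tw59_modulus_const`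
(`|W_G|` constant on its support: pairing + translation identities), **`tw59_rel_bent`** (`W_G² = 4096` on ALL of `P_f`:
`#supp·M² = 2²³`, `1024 < #supp ≤ 2048`, `M ∈ ℤ`), `tw59_translation_law` (`W_G(w ⊕ m) = ±(−1)^{a·w} W_G(w)` for directions `m` of `P_f`).
References: O. Rothaus (1976); C. Carlet (CUP 2021) §5–6; R. O'Donnell (2014) §3.3.  Proved from Mathlib and the tree.
-/

set_option linter.dupNamespace false -- D-0017: single-problem summit ⇒ `QuantumAdvantage.QuantumAdvantage` by design

noncomputable section

namespace Summit.QuantumAdvantage.QuantumAdvantage.Theorems.CubicForrelation.NearExactIsExact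

open Finset
open Literature.Computability.QuantumComplexity
open Literature.Computability.QuantumComplexity.BuzetChailloux (bxor zeroVec bxor_bxor_cancel_left bxor_zeroVec zeroVec_bxor bxor_comm
  bxor_self twist_zeroVec_right twist_bxor_right signOf_sq)
open Literature.Computability.QuantumComplexity.Simon (twist_eq_one_or twist_sq)
open Literature.Computability.QuantumComplexity.DerivativeWalsh (W twist_bxor_left sum_W_sq)

/-! ### The relative transform of `G = σ·1_{P_g}` -/

/-- `W_G(z) = Σ_{x ∈ P_g} (−1)^{D̄(x)} (−1)^{x·z}` for `G = (−1)^{D̄}·1_{P_g}`. [folklore] -/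
theorem tw59_WG_eq (γ : Fin (6 + 6) → Bool) (tg : ℝ) (D : (Fin (6 + 6) → Bool) → Bool) (G : (Fin (6 + 6) → Bool) → ℝ)
    (hG : ∀ x, G x = if twist γ x = tg then signOf (D x) else 0) (z : Fin (6 + 6) → Bool) :
    W G z = ∑ x ∈ univ.filter (fun x : Fin (6 + 6) → Bool => twist γ x = tg), signOf (D x) * twist x z := by
  unfold W; rw [sum_filter]
  refine sum_congr rfl fun x _ => ?_
  rw [hG x]; split_ifs <;> simp

/-- `W_G(z)` is an integer. [folklore] -/
theorem tw59_WG_int (γ : Fin (6 + 6) → Bool) (tg : ℝ) (D : (Fin (6 + 6) → Bool) → Bool) (G : (Fin (6 + 6) → Bool) → ℝ)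
    (hG : ∀ x, G x = if twist γ x = tg then signOf (D x) else 0) (z : Fin (6 + 6) → Bool) : ∃ N : ℤ, W G z = N := by
  refine ⟨∑ x ∈ univ.filter (fun x : Fin (6 + 6) → Bool => twist γ x = tg),
    sZ (D x) * (if twist x z = 1 then 1 else -1), ?_⟩
  rw [tw59_WG_eq γ tg D G hG z]
  push_cast
  refine sum_congr rfl fun x _ => ?_
  rw [tp_sZ_cast]
  rcases twist_eq_one_or x z with h | h
  · rw [if_pos h, h]
  · rw [if_neg (by rw [h]; norm_num), h]

/-- `Σ_x G(x)² = 2048` (`G = ±1` on the `2048`-point hyperplane, `0` off it). [folklore] -/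
theorem tw59_G_sq_sum (γ : Fin (6 + 6) → Bool) (hγ : γ ≠ zeroVec) (tg : ℝ) (htg : tg = 1 ∨ tg = -1)
    (D : (Fin (6 + 6) → Bool) → Bool) (G : (Fin (6 + 6) → Bool) → ℝ)
    (hG : ∀ x, G x = if twist γ x = tg then signOf (D x) else 0) : ∑ x, G x ^ 2 = 2048 := by
  have e : ∀ x : Fin (6 + 6) → Bool, G x ^ 2 = if twist γ x = tg then 1 else 0 := by
    intro x; rw [hG x]
    by_cases h : twist γ x = tg
    · rw [if_pos h, if_pos h, signOf_sq]
    · rw [if_neg h, if_neg h]; norm_num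
  rw [sum_congr rfl fun x _ => e x, sum_boole, tw59_card_half γ hγ tg htg]
  norm_num

/-! ### Periodicity of `G` and the residual `R` -/

/-- The sign `(−1)^{D̄}` is (anti)periodic along the partner's normal on `P_g`: `(−1)^{D̄(x ⊕ c)} = t_f (−1)^{D̄(x)}` for `x ∈ P_g`
(both are `≡` the residual mod 4, and the residual is (anti)periodic, `tw59_residual_periodic`). [this work] -/
theorem tw59_sigma_periodic (f g : (Fin (6 + 6) → Bool) → Bool) (u' v' : (Fin (6 + 6) → Bool) → ℤ)
    (hu' : ∀ x, W (fun y => signOf (g y)) x = (2 : ℝ) ^ 5 * (u' x : ℝ))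
    (hv' : ∀ x, W (fun y => signOf (f y)) x = (2 : ℝ) ^ 5 * (v' x : ℝ))
    (γ : Fin (6 + 6) → Bool) (tg : ℝ) (hPg : ∀ x, (Odd (u' x) ↔ twist γ x = tg))
    (c : Fin (6 + 6) → Bool) (tf : ℝ) (htf : tf = 1 ∨ tf = -1) (hPf : ∀ z, (Odd (v' z) ↔ twist c z = tf))
    (hofff : ∀ z, ¬ Odd (v' z) → v' z = 2 * sZ (g z)) (hγc : twist γ c = 1)
    (D : (Fin (6 + 6) → Bool) → Bool) (hDig : ∀ x, Odd (u' x) → (4 : ℤ) ∣ u' x - 2 * sZ (f x) - sZ (D x))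
    (x : Fin (6 + 6) → Bool) (hx : Odd (u' x)) : signOf (D (bxor x c)) = tf * signOf (D x) := by
  have hxc : Odd (u' (bxor x c)) := (hPg _).2 (by rw [twist_bxor_right, hγc, mul_one]; exact (hPg x).1 hx)
  have h1 := hDig x hx
  have h2 := hDig (bxor x c) hxc
  have hper := tw59_residual_periodic f g u' v' hu' hv' c tf hPf hofff x
  have hs : ∀ b : Bool, sZ b = 1 ∨ sZ b = -1 := fun b => by cases b <;> simp [sZ]
  rw [← tp_sZ_cast, ← tp_sZ_cast]
  rcases htf with ht | ht
  · rw [ht, one_mul] at hper ⊢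
    have hper' : u' (bxor x c) - 2 * sZ (f (bxor x c)) = u' x - 2 * sZ (f x) := by exact_mod_cast hper
    have h3 : (4 : ℤ) ∣ sZ (D (bxor x c)) - sZ (D x) := by
      have := dvd_sub h1 h2; rw [hper'] at this
      have e : u' x - 2 * sZ (f x) - sZ (D x) - (u' x - 2 * sZ (f x) - sZ (D (bxor x c))) = sZ (D (bxor x c)) - sZ (D x) := by ring
      rwa [e] at this
    have h4 : sZ (D (bxor x c)) = sZ (D x) := by
      rcases hs (D (bxor x c)) with ha | ha <;> rcases hs (D x) with hb | hb <;> rw [ha, hb] at h3 ⊢ <;> omega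
    exact_mod_cast h4
  · rw [ht] at hper ⊢
    have hper' : u' (bxor x c) - 2 * sZ (f (bxor x c)) = -(u' x - 2 * sZ (f x)) := by
      have : ((u' (bxor x c) - 2 * sZ (f (bxor x c)) : ℤ) : ℝ) = (((-(u' x - 2 * sZ (f x))) : ℤ) : ℝ) := by
        rw [hper]; push_cast; ring
      exact_mod_cast this
    have h3 : (4 : ℤ) ∣ sZ (D (bxor x c)) + sZ (D x) := by
      have := dvd_add h1 h2; rw [hper'] at this
      have e : u' x - 2 * sZ (f x) - sZ (D x) + (-(u' x - 2 * sZ (f x)) - sZ (D (bxor x c))) = -(sZ (D (bxor x c)) + sZ (D x)) := by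
        ring
      rw [e] at this
      exact (dvd_neg).1 this
    have h4 : sZ (D (bxor x c)) = -sZ (D x) := by
      rcases hs (D (bxor x c)) with ha | ha <;> rcases hs (D x) with hb | hb <;> rw [ha, hb] at h3 ⊢ <;> omega
    have : ((sZ (D (bxor x c)) : ℤ) : ℝ) = (((-sZ (D x)) : ℤ) : ℝ) := by exact_mod_cast h4
    rw [this]; push_cast; ring

/-- `G = (−1)^{D̄}·1_{P_g}` is (anti)periodic: `G(x ⊕ c) = t_f·G(x)`. [this work] -/
theorem tw59_G_periodic (f g : (Fin (6 + 6) → Bool) → Bool) (u' v' : (Fin (6 + 6) → Bool) → ℤ)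
    (hu' : ∀ x, W (fun y => signOf (g y)) x = (2 : ℝ) ^ 5 * (u' x : ℝ))
    (hv' : ∀ x, W (fun y => signOf (f y)) x = (2 : ℝ) ^ 5 * (v' x : ℝ))
    (γ : Fin (6 + 6) → Bool) (tg : ℝ) (hPg : ∀ x, (Odd (u' x) ↔ twist γ x = tg))
    (c : Fin (6 + 6) → Bool) (tf : ℝ) (htf : tf = 1 ∨ tf = -1) (hPf : ∀ z, (Odd (v' z) ↔ twist c z = tf))
    (hofff : ∀ z, ¬ Odd (v' z) → v' z = 2 * sZ (g z)) (hγc : twist γ c = 1)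
    (D : (Fin (6 + 6) → Bool) → Bool) (hDig : ∀ x, Odd (u' x) → (4 : ℤ) ∣ u' x - 2 * sZ (f x) - sZ (D x))
    (G : (Fin (6 + 6) → Bool) → ℝ) (hG : ∀ x, G x = if twist γ x = tg then signOf (D x) else 0) (x : Fin (6 + 6) → Bool) :
    G (bxor x c) = tf * G x := by
  rw [hG, hG, twist_bxor_right, hγc, mul_one]
  by_cases hx : twist γ x = tg
  · rw [if_pos hx, if_pos hx]
    exact tw59_sigma_periodic f g u' v' hu' hv' γ tg hPg c tf htf hPf hofff hγc D hDig x ((hPg x).2 hx)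
  · rw [if_neg hx, if_neg hx, mul_zero]

/-- Hence `W_G` vanishes off `P_f`. [this work] -/
theorem tw59_WG_off (f g : (Fin (6 + 6) → Bool) → Bool) (u' v' : (Fin (6 + 6) → Bool) → ℤ)
    (hu' : ∀ x, W (fun y => signOf (g y)) x = (2 : ℝ) ^ 5 * (u' x : ℝ))
    (hv' : ∀ x, W (fun y => signOf (f y)) x = (2 : ℝ) ^ 5 * (v' x : ℝ))
    (γ : Fin (6 + 6) → Bool) (tg : ℝ) (hPg : ∀ x, (Odd (u' x) ↔ twist γ x = tg))
    (c : Fin (6 + 6) → Bool) (tf : ℝ) (htf : tf = 1 ∨ tf = -1) (hPf : ∀ z, (Odd (v' z) ↔ twist c z = tf))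
    (hofff : ∀ z, ¬ Odd (v' z) → v' z = 2 * sZ (g z)) (hγc : twist γ c = 1)
    (D : (Fin (6 + 6) → Bool) → Bool) (hDig : ∀ x, Odd (u' x) → (4 : ℤ) ∣ u' x - 2 * sZ (f x) - sZ (D x))
    (G : (Fin (6 + 6) → Bool) → ℝ) (hG : ∀ x, G x = if twist γ x = tg then signOf (D x) else 0)
    (z : Fin (6 + 6) → Bool) (hz : twist c z ≠ tf) : W G z = 0 :=
  tw59_support_of_periodic G c tf htf (tw59_G_periodic f g u' v' hu' hv' γ tg hPg c tf htf hPf hofff hγc D hDig G hG) z hz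

/-! ### The residual `R = e_g − G` and its transform -/

/-- `W_R = −64·e_f − W_G` for `R = e_g − G` (linearity and `tw_residual_duality`). [this work] -/
theorem tw59_WR_eq (f g : (Fin (6 + 6) → Bool) → Bool) (u' v' : (Fin (6 + 6) → Bool) → ℤ)
    (hu' : ∀ x, W (fun y => signOf (g y)) x = (2 : ℝ) ^ 5 * (u' x : ℝ))
    (hv' : ∀ x, W (fun y => signOf (f y)) x = (2 : ℝ) ^ 5 * (v' x : ℝ)) (G : (Fin (6 + 6) → Bool) → ℝ)
    (z : Fin (6 + 6) → Bool) :
    W (fun x => ((u' x - 2 * sZ (f x) : ℤ) : ℝ) - G x) z = -64 * ((v' z - 2 * sZ (g z) : ℤ) : ℝ) - W G z := by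
  have h := tw_residual_duality f g u' v' hu' hv' z
  unfold W at h ⊢; rw [← h, ← sum_sub_distrib]
  exact sum_congr rfl fun x _ => by ring

/-- Pointwise: if `4 ∣ e − σ` with `σ = ±1` then `(e − σ)² ≤ 2(e² − 1)` (as `|e + σ| ≥ 2`). [folklore] -/
theorem tw59_sq_sub_le (e σ : ℤ) (hσ : σ = 1 ∨ σ = -1) (h : (4 : ℤ) ∣ e - σ) : (e - σ) ^ 2 ≤ 2 * (e ^ 2 - 1) := by
  obtain ⟨k, hk⟩ := h
  have he : e = σ + 4 * k := by linarith
  subst he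
  rcases hσ with rfl | rfl
  · by_cases hk0 : 0 ≤ k
    · nlinarith [mul_nonneg hk0 (show (0 : ℤ) ≤ k + 1 by omega)]
    · nlinarith [mul_nonneg (show (0 : ℤ) ≤ -k by omega) (show (0 : ℤ) ≤ -(k + 1) by omega)]
  · by_cases hk0 : k ≤ 0
    · nlinarith [mul_nonneg (show (0 : ℤ) ≤ -k by omega) (show (0 : ℤ) ≤ -(k - 1) by omega)]
    · nlinarith [mul_nonneg (show (0 : ℤ) ≤ k by omega) (show (0 : ℤ) ≤ k - 1 by omega)]

/-- **Residual energy**: `Σ_x R(x)² ≤ 2·(2¹⁵(1 − Φ) − 2048)` (`R = 0` off `P_g`, `(e−σ)² ≤ 2(e²−1)` on it, budget `Σe² = 2¹⁵(1−Φ)`,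
`#P_g = 2048`). [this work] -/
theorem tw59_R_sq_le (f g : (Fin (6 + 6) → Bool) → Bool) (u' : (Fin (6 + 6) → Bool) → ℤ)
    (hu' : ∀ x, W (fun y => signOf (g y)) x = (2 : ℝ) ^ 5 * (u' x : ℝ))
    (γ : Fin (6 + 6) → Bool) (hγ : γ ≠ zeroVec) (tg : ℝ) (htg : tg = 1 ∨ tg = -1) (hPg : ∀ x, (Odd (u' x) ↔ twist γ x = tg))
    (hoffg : ∀ y, ¬ Odd (u' y) → u' y = 2 * sZ (f y))
    (D : (Fin (6 + 6) → Bool) → Bool) (hDig : ∀ x, Odd (u' x) → (4 : ℤ) ∣ u' x - 2 * sZ (f x) - sZ (D x))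
    (G : (Fin (6 + 6) → Bool) → ℝ) (hG : ∀ x, G x = if twist γ x = tg then signOf (D x) else 0) :
    ∑ x, (((u' x - 2 * sZ (f x) : ℤ) : ℝ) - G x) ^ 2 ≤ 2 * (32768 * (1 - forrelation f g) - 2048) := by
  have hpt : ∀ x : Fin (6 + 6) → Bool, (((u' x - 2 * sZ (f x) : ℤ) : ℝ) - G x) ^ 2 ≤
      2 * (((u' x - 2 * sZ (f x)) ^ 2 : ℤ) : ℝ) - 2 * (if twist γ x = tg then (1 : ℝ) else 0) := by
    intro x
    rw [hG x]
    by_cases hx : twist γ x = tg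
    · rw [if_pos hx, if_pos hx, ← tp_sZ_cast]
      have hodd := (hPg x).2 hx
      have hs : sZ (D x) = 1 ∨ sZ (D x) = -1 := by cases D x <;> simp [sZ]
      have hle := tw59_sq_sub_le (u' x - 2 * sZ (f x)) (sZ (D x)) hs (hDig x hodd)
      have h' : (((u' x - 2 * sZ (f x) - sZ (D x)) ^ 2 : ℤ) : ℝ) ≤ ((2 * ((u' x - 2 * sZ (f x)) ^ 2 - 1) : ℤ) : ℝ) := by
        exact_mod_cast hle
      push_cast at h' ⊢
      linarith
    · rw [if_neg hx, if_neg hx]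
      have h0 : u' x - 2 * sZ (f x) = 0 := by
        rw [hoffg x (fun h => hx ((hPg x).1 h))]; ring
      rw [h0]; push_cast; norm_num
  have hsum := Finset.sum_le_sum fun x (_ : x ∈ (univ : Finset (Fin (6 + 6) → Bool))) => hpt x
  rw [sum_sub_distrib, ← mul_sum, ← mul_sum, sum_boole, tw59_card_half γ hγ tg htg] at hsum
  have hB := tw59_budget f g u' hu'
  push_cast at hB hsum ⊢
  rw [hB] at hsum
  linarith

/-! ### Relative bentness -/

/-- **Zero count.**  In the window, `W_G` is non-zero at more than `1024` points of `P_f` (at a zero, `W_R = −64 e_f` with `e_f` odd,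
and `Σ W_R² = 4096 Σ R² < 4096·1024`). [this work] -/
theorem tw59_support_gt (f g : (Fin (6 + 6) → Bool) → Bool) (u' v' : (Fin (6 + 6) → Bool) → ℤ)
    (hu' : ∀ x, W (fun y => signOf (g y)) x = (2 : ℝ) ^ 5 * (u' x : ℝ))
    (hv' : ∀ x, W (fun y => signOf (f y)) x = (2 : ℝ) ^ 5 * (v' x : ℝ))
    (γ : Fin (6 + 6) → Bool) (hγ : γ ≠ zeroVec) (tg : ℝ) (htg : tg = 1 ∨ tg = -1) (hPg : ∀ x, (Odd (u' x) ↔ twist γ x = tg))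
    (hoffg : ∀ y, ¬ Odd (u' y) → u' y = 2 * sZ (f y))
    (c : Fin (6 + 6) → Bool) (hc : c ≠ zeroVec) (tf : ℝ) (htf : tf = 1 ∨ tf = -1) (hPf : ∀ z, (Odd (v' z) ↔ twist c z = tf))
    (D : (Fin (6 + 6) → Bool) → Bool) (hDig : ∀ x, Odd (u' x) → (4 : ℤ) ∣ u' x - 2 * sZ (f x) - sZ (D x))
    (G : (Fin (6 + 6) → Bool) → ℝ) (hG : ∀ x, G x = if twist γ x = tg then signOf (D x) else 0)
    (hlo : (59 / 64 : ℝ) < forrelation f g) :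
    1024 < #(univ.filter fun z : Fin (6 + 6) → Bool => twist c z = tf ∧ W G z ≠ 0) := by
  set R : (Fin (6 + 6) → Bool) → ℝ := fun x => ((u' x - 2 * sZ (f x) : ℤ) : ℝ) - G x with hR
  -- at a zero of `W_G` on `P_f`, `W_R² ≥ 4096`
  have hzero : ∀ z, twist c z = tf → W G z = 0 → (4096 : ℝ) ≤ W R z ^ 2 := by
    intro z hz h0
    have hW := tw59_WR_eq f g u' v' hu' hv' G z
    rw [h0, sub_zero] at hW
    have hodd : Odd (v' z - 2 * sZ (g z)) := Int.odd_sub.2 (iff_of_true ((hPf z).2 hz) ⟨sZ (g z), two_mul _⟩)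
    have h1 := tw59_one_le_sq_of_odd _ hodd
    have h1' : (1 : ℝ) ≤ (((v' z - 2 * sZ (g z)) : ℤ) : ℝ) ^ 2 := by exact_mod_cast h1
    change (4096 : ℝ) ≤ W R z ^ 2
    rw [hW]; nlinarith
  -- Parseval for `R`
  have hPars : ∑ z, W R z ^ 2 = 4096 * ∑ x, R x ^ 2 := by rw [sum_W_sq]; norm_num
  have hRle := tw59_R_sq_le f g u' hu' γ hγ tg htg hPg hoffg D hDig G hG
  have hlt : ∑ z, W R z ^ 2 < 4096 * 1024 := by
    rw [hPars]
    have : ∑ x, R x ^ 2 < 1024 := by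
      change ∑ x, (((u' x - 2 * sZ (f x) : ℤ) : ℝ) - G x) ^ 2 < 1024
      linarith
    linarith
  -- count
  set Z0 := univ.filter (fun z : Fin (6 + 6) → Bool => twist c z = tf ∧ W G z = 0) with hZ0
  have hZ0le : (4096 : ℝ) * #Z0 ≤ ∑ z, W R z ^ 2 := by
    have h1 : ∑ z ∈ Z0, (4096 : ℝ) ≤ ∑ z ∈ Z0, W R z ^ 2 :=
      sum_le_sum fun z hz => by
        rw [hZ0, mem_filter] at hz
        exact hzero z hz.2.1 hz.2.2
    have h2 : ∑ z ∈ Z0, W R z ^ 2 ≤ ∑ z, W R z ^ 2 :=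
      sum_le_sum_of_subset_of_nonneg (subset_univ _) fun z _ _ => sq_nonneg _
    rw [sum_const, nsmul_eq_mul] at h1
    linarith
  have hZ0lt : #Z0 < 1024 := by
    have h : (#Z0 : ℝ) < 1024 := by nlinarith
    exact_mod_cast h
  have hsplit : #Z0 + #(univ.filter fun z : Fin (6 + 6) → Bool => twist c z = tf ∧ W G z ≠ 0) = 2048 := by
    rw [hZ0, ← tw59_card_half c hc tf htf, ← filter_filter, ← filter_filter, card_filter_add_card_filter_not]
  omega

/-- **Constant modulus on the support.**  If `W_G(z), W_G(z') ≠ 0` then `|W_G(z')| = |W_G(z)|` (the product is non-zero, so some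
direction `a` makes the inner summand constant, `tw59_pairing_ne_zero`; then translate, `tw59_translate`). [this work] -/
theorem tw59_modulus_const (γ : Fin (6 + 6) → Bool) (hγ : γ ≠ zeroVec) (tg : ℝ) (htg : tg = 1 ∨ tg = -1)
    (D : (Fin (6 + 6) → Bool) → Bool) (hD : IsDegLeFun 2 D)
    (G : (Fin (6 + 6) → Bool) → ℝ) (hG : ∀ x, G x = if twist γ x = tg then signOf (D x) else 0)
    (z z' : Fin (6 + 6) → Bool) (hz : W G z ≠ 0) (hz' : W G z' ≠ 0) : |W G z'| = |W G z| := by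
  set P := univ.filter (fun x : Fin (6 + 6) → Bool => twist γ x = tg) with hPdef
  set V := univ.filter (fun x : Fin (6 + 6) → Bool => twist γ x = 1) with hVdef
  have hP : ∀ x, x ∈ P ↔ twist γ x = tg := fun x => by rw [hPdef, mem_filter]; simp
  have hV : ∀ x, x ∈ V ↔ twist γ x = 1 := fun x => by rw [hVdef, mem_filter]; simp
  have hWz := tw59_WG_eq γ tg D G hG z
  have hWz' := tw59_WG_eq γ tg D G hG z'
  have hne : (∑ x ∈ P, signOf (D x) * twist x z) * (∑ x ∈ P, signOf (D x) * twist x z') ≠ 0 := by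
    rw [← hWz, ← hWz']; exact mul_ne_zero hz hz'
  obtain ⟨a, ha, κ, hκ⟩ := tw59_pairing_ne_zero P V γ tg htg hP hV D hD z z' hne
  have htr := tw59_translate P γ tg hP D a (bxor z z') ha κ hκ z
  rw [bxor_bxor_cancel_left] at htr
  -- `|κ| = 1`: evaluate at a point of `P`
  have hPne : P.Nonempty := by
    rw [← card_pos, hPdef, tw59_card_half γ hγ tg htg]; norm_num
  obtain ⟨x₀, hx₀⟩ := hPne
  have hκ1 : |κ| = 1 := by
    rw [← hκ x₀ hx₀, abs_mul, abs_mul]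
    have h1 : ∀ b : Bool, |signOf b| = 1 := fun b => by cases b <;> simp [signOf]
    rw [h1, h1]
    rcases twist_eq_one_or x₀ (bxor z z') with h | h <;> rw [h] <;> norm_num
  have hta : |twist a z| = 1 := by rcases twist_eq_one_or a z with h | h <;> rw [h] <;> norm_num
  rw [hWz', hWz, htr, abs_mul, abs_mul, hκ1, hta, one_mul, one_mul]

/-- Arithmetic of the counting step: `k·q = 2²³` with `1024 < k ≤ 2048` forces `k = 2048`, `q = 4096`. [folklore] -/
theorem tw59_count_arith (k q : ℕ) (h : k * q = 2 ^ 23) (hk1 : 1024 < k) (hk2 : k ≤ 2048) : k = 2048 ∧ q = 4096 := by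
  have hdvd : k ∣ 2 ^ 23 := Dvd.intro q h
  obtain ⟨j, hj, hkj⟩ := (Nat.dvd_prime_pow Nat.prime_two).1 hdvd
  subst hkj
  interval_cases j
  all_goals first
    | (exfalso; norm_num at hk1; done)
    | (exfalso; norm_num at hk2; done)
    | (norm_num at h ⊢; omega)

/-- **Relative bentness.**  In the window, `W_G(z)² = 4096` at EVERY point of `P_f`: the support has `> 1024` points
(`tw59_support_gt`), the modulus is constant there (`tw59_modulus_const`), `W_G = 0` off `P_f` (`tw59_WG_off`), and Parseval gives
`#supp · M² = 4096·Σ G² = 2²³` with `M ∈ ℤ` — so `#supp = 2048`, `M² = 4096`. [this work] -/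
theorem tw59_rel_bent (f g : (Fin (6 + 6) → Bool) → Bool) (u' v' : (Fin (6 + 6) → Bool) → ℤ)
    (hu' : ∀ x, W (fun y => signOf (g y)) x = (2 : ℝ) ^ 5 * (u' x : ℝ))
    (hv' : ∀ x, W (fun y => signOf (f y)) x = (2 : ℝ) ^ 5 * (v' x : ℝ))
    (γ : Fin (6 + 6) → Bool) (hγ : γ ≠ zeroVec) (tg : ℝ) (htg : tg = 1 ∨ tg = -1) (hPg : ∀ x, (Odd (u' x) ↔ twist γ x = tg))
    (hoffg : ∀ y, ¬ Odd (u' y) → u' y = 2 * sZ (f y))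
    (c : Fin (6 + 6) → Bool) (hc : c ≠ zeroVec) (tf : ℝ) (htf : tf = 1 ∨ tf = -1) (hPf : ∀ z, (Odd (v' z) ↔ twist c z = tf))
    (hofff : ∀ z, ¬ Odd (v' z) → v' z = 2 * sZ (g z)) (hγc : twist γ c = 1)
    (D : (Fin (6 + 6) → Bool) → Bool) (hD : IsDegLeFun 2 D) (hDig : ∀ x, Odd (u' x) → (4 : ℤ) ∣ u' x - 2 * sZ (f x) - sZ (D x))
    (G : (Fin (6 + 6) → Bool) → ℝ) (hG : ∀ x, G x = if twist γ x = tg then signOf (D x) else 0)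
    (hlo : (59 / 64 : ℝ) < forrelation f g) (z : Fin (6 + 6) → Bool) (hz : twist c z = tf) : W G z ^ 2 = 4096 := by
  have hgt := tw59_support_gt f g u' v' hu' hv' γ hγ tg htg hPg hoffg c hc tf htf hPf D hDig G hG hlo
  set Sp := univ.filter (fun z : Fin (6 + 6) → Bool => twist c z = tf ∧ W G z ≠ 0) with hSp
  have hSpne : Sp.Nonempty := by rw [← card_pos]; omega
  obtain ⟨z₀, hz₀⟩ := hSpne
  have hz₀' := hz₀
  rw [hSp, mem_filter] at hz₀'
  obtain ⟨N, hN⟩ := tw59_WG_int γ tg D G hG z₀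
  -- the modulus is `|N|` on the whole support
  have hmod : ∀ w ∈ Sp, W G w ^ 2 = (N : ℝ) ^ 2 := by
    intro w hw
    rw [hSp, mem_filter] at hw
    have h := tw59_modulus_const γ hγ tg htg D hD G hG z₀ w hz₀'.2.2 hw.2.2
    rw [← sq_abs, h, sq_abs, hN]
  -- Parseval: `Σ_z W_G² = 4096 · 2048`, and the sum lives on `Sp`
  have hPars : ∑ w, W G w ^ 2 = 4096 * 2048 := by
    rw [sum_W_sq, tw59_G_sq_sum γ hγ tg htg D G hG]; norm_num
  have hsupp : ∑ w, W G w ^ 2 = ∑ w ∈ Sp, W G w ^ 2 := by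
    rw [← sum_filter_add_sum_filter_not univ (fun w : Fin (6 + 6) → Bool => twist c w = tf ∧ W G w ≠ 0)]
    have h0 : ∑ w ∈ univ.filter (fun w : Fin (6 + 6) → Bool => ¬ (twist c w = tf ∧ W G w ≠ 0)), W G w ^ 2 = 0 := by
      refine sum_eq_zero fun w hw => ?_
      rw [mem_filter] at hw
      by_cases hwc : twist c w = tf
      · have : W G w = 0 := by
          by_contra hne; exact hw.2 ⟨hwc, hne⟩
        rw [this]; ring
      · rw [tw59_WG_off f g u' v' hu' hv' γ tg hPg c tf htf hPf hofff hγc D hDig G hG w hwc]; ring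
    rw [h0, add_zero]
  rw [hsupp, sum_congr rfl hmod, sum_const, nsmul_eq_mul] at hPars
  -- integer arithmetic: `#Sp · N² = 2²³`
  have hcard_le : #Sp ≤ 2048 := by
    rw [hSp, ← tw59_card_half c hc tf htf, ← filter_filter]
    exact card_filter_le _ _
  have hnat : #Sp * (N.natAbs ^ 2) = 2 ^ 23 := by
    have h1 : ((#Sp * N.natAbs ^ 2 : ℕ) : ℝ) = ((2 ^ 23 : ℕ) : ℝ) := by
      push_cast
      rw [Nat.cast_natAbs, Int.cast_abs, sq_abs, hPars]; norm_num
    exact_mod_cast h1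
  obtain ⟨hk, hq⟩ := tw59_count_arith _ _ hnat hgt hcard_le
  -- every point of `P_f` is in the support
  have hzSp : z ∈ Sp := by
    have hfull : Sp = univ.filter (fun z : Fin (6 + 6) → Bool => twist c z = tf) := by
      apply eq_of_subset_of_card_le
      · intro w hw; rw [hSp, mem_filter] at hw; rw [mem_filter]; exact ⟨hw.1, hw.2.1⟩
      · rw [tw59_card_half c hc tf htf, hk]
    rw [hfull, mem_filter]; exact ⟨mem_univ _, hz⟩
  rw [hmod z hzSp]
  have hq' : ((N.natAbs ^ 2 : ℕ) : ℝ) = ((4096 : ℕ) : ℝ) := by rw [hq]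
  push_cast at hq'
  rw [Nat.cast_natAbs, Int.cast_abs, sq_abs] at hq'
  exact hq'

/-- **Translation law.**  In the window, for every direction `m` of `P_f` (`(−1)^{c·m} = 1`) there are a sign `κ = ±1` and a vector `a`
with `W_G(w ⊕ m) = κ·(−1)^{a·w}·W_G(w)` for ALL `w` (pick `z ∈ P_f`; `W_G(z)W_G(z⊕m) ≠ 0` by relative bentness; pairing). [this work] -/
theorem tw59_translation_law (f g : (Fin (6 + 6) → Bool) → Bool) (u' v' : (Fin (6 + 6) → Bool) → ℤ)
    (hu' : ∀ x, W (fun y => signOf (g y)) x = (2 : ℝ) ^ 5 * (u' x : ℝ))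
    (hv' : ∀ x, W (fun y => signOf (f y)) x = (2 : ℝ) ^ 5 * (v' x : ℝ))
    (γ : Fin (6 + 6) → Bool) (hγ : γ ≠ zeroVec) (tg : ℝ) (htg : tg = 1 ∨ tg = -1) (hPg : ∀ x, (Odd (u' x) ↔ twist γ x = tg))
    (hoffg : ∀ y, ¬ Odd (u' y) → u' y = 2 * sZ (f y))
    (c : Fin (6 + 6) → Bool) (hc : c ≠ zeroVec) (tf : ℝ) (htf : tf = 1 ∨ tf = -1) (hPf : ∀ z, (Odd (v' z) ↔ twist c z = tf))
    (hofff : ∀ z, ¬ Odd (v' z) → v' z = 2 * sZ (g z)) (hγc : twist γ c = 1)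
    (D : (Fin (6 + 6) → Bool) → Bool) (hD : IsDegLeFun 2 D) (hDig : ∀ x, Odd (u' x) → (4 : ℤ) ∣ u' x - 2 * sZ (f x) - sZ (D x))
    (G : (Fin (6 + 6) → Bool) → ℝ) (hG : ∀ x, G x = if twist γ x = tg then signOf (D x) else 0)
    (hlo : (59 / 64 : ℝ) < forrelation f g) (m : Fin (6 + 6) → Bool) (hm : twist c m = 1) :
    ∃ (κ : ℝ) (a : Fin (6 + 6) → Bool), (κ = 1 ∨ κ = -1) ∧ ∀ w, W G (bxor w m) = κ * twist a w * W G w := by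
  set P := univ.filter (fun x : Fin (6 + 6) → Bool => twist γ x = tg) with hPdef
  set V := univ.filter (fun x : Fin (6 + 6) → Bool => twist γ x = 1) with hVdef
  have hP : ∀ x, x ∈ P ↔ twist γ x = tg := fun x => by rw [hPdef, mem_filter]; simp
  have hV : ∀ x, x ∈ V ↔ twist γ x = 1 := fun x => by rw [hVdef, mem_filter]; simp
  -- a point of `P_f` and its translate
  have hPfne : (univ.filter fun z : Fin (6 + 6) → Bool => twist c z = tf).Nonempty := by
    rw [← card_pos, tw59_card_half c hc tf htf]; norm_num
  obtain ⟨z, hz⟩ := hPfne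
  rw [mem_filter] at hz
  have hz' : twist c (bxor z m) = tf := by rw [twist_bxor_right, hz.2, hm, mul_one]
  have hb := tw59_rel_bent f g u' v' hu' hv' γ hγ tg htg hPg hoffg c hc tf htf hPf hofff hγc D hD hDig G hG hlo
  have hne : W G z ≠ 0 := by intro h; have := hb z hz.2; rw [h] at this; norm_num at this
  have hne' : W G (bxor z m) ≠ 0 := by intro h; have := hb _ hz'; rw [h] at this; norm_num at this
  have hWz := tw59_WG_eq γ tg D G hG z
  have hWz' := tw59_WG_eq γ tg D G hG (bxor z m)
  have hprod : (∑ x ∈ P, signOf (D x) * twist x z) * (∑ x ∈ P, signOf (D x) * twist x (bxor z m)) ≠ 0 := by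
    rw [← hWz, ← hWz']; exact mul_ne_zero hne hne'
  obtain ⟨a, ha, κ, hκ⟩ := tw59_pairing_ne_zero P V γ tg htg hP hV D hD z (bxor z m) hprod
  rw [bxor_bxor_cancel_left] at hκ
  have hPne : P.Nonempty := by
    rw [← card_pos, hPdef, tw59_card_half γ hγ tg htg]; norm_num
  obtain ⟨x₀, hx₀⟩ := hPne
  have hκ1 : κ = 1 ∨ κ = -1 := by
    rw [← hκ x₀ hx₀]
    have hs : ∀ b : Bool, signOf b = 1 ∨ signOf b = -1 := fun b => by cases b <;> simp [signOf]
    rcases hs (D x₀) with h1 | h1 <;> rcases hs (D (bxor x₀ a)) with h2 | h2 <;>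
      rcases twist_eq_one_or x₀ m with h3 | h3 <;> rw [h1, h2, h3] <;> norm_num
  refine ⟨κ, a, hκ1, fun w => ?_⟩
  rw [tw59_WG_eq γ tg D G hG, tw59_WG_eq γ tg D G hG, tw59_translate P γ tg hP D a m ha κ hκ w]

end Summit.QuantumAdvantage.QuantumAdvantage.Theorems.CubicForrelation.NearExactIsExact

end
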